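import Summits.MatrixMultiplication.OmegaCensus.STPPKill223332332Z46KA
import Literature.Computability.AlgebraicComplexity.STPPMapHom
import Literature.Computability.AlgebraicComplexity.STPPTranslation
import Literature.Computability.AlgebraicComplexity.STPPGlobalShift

/-!
# ω-census (abelian STPP census): `{(2,2,3),(3,3,2),(3,3,2)}` at order 46 — transport to `ℤ/46ℤ` and the symmetry normal forms (kernel)

HONEST FRAMING (pub-omega census; verbatim): lottery ticket; floor = certified bounds/negative ranges.
Census STRUCTURE (seat pub-omega-stpp-2 gen 32, 2026-08-30), family (b2); plumbing for the clash files of HOME `pub-omega-stpp-2-g32/CASEMAP.md`.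
* `exists_family_zmod46`: every abelian group of order `46` is cyclic (`IsZGroup.of_squarefree`), so an STPP family with given card vectors in it yields
  one in `ℤ/46ℤ` (`zmodAddCyclicAddEquiv` + `IsSTPP.map_addEquiv`).
* symmetries inside `ℤ/46ℤ` and their effect on progressions: scaling by a unit (`isSTPP_image_mul`, `image_mul_apFinset`, `IsAP.image_mul`), per-block
  translation (`IsSTPP.translate`, tree) and the global `B`/`C` shifts (`IsSTPP.shiftBC`, tree); `image_add_apFinset`.
* `normalize_C` (example normal form): if some `Cⱼ = {c, c + d}` with `d` a unit, there is an STPP family of the same pattern with `Cⱼ = {0, 1}`.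
Nothing here is progress on `ω`.

References: H. Cohn, R. Kleinberg, B. Szegedy, C. Umans, FOCS 2005 (arXiv:math/0511460), Def. 5.1 (translation/automorphism invariance after Def. 5.1).
-/

open Finset
open scoped Pointwise

namespace Summit.MatrixMultiplication.OmegaCensus.Z46

open Literature.Computability.AlgebraicComplexity
open Literature.Combinatorics.Additive

/-! ## §1 Transport to `ℤ/46ℤ` -/

/-- **Every STPP family in an abelian group of order `46` has a copy in `ℤ/46ℤ` with the same card vectors** (a group of square-free order is cyclic).
[cite: CohnKleinbergSzegedyUmans2005, Def. 5.1] -/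
theorem exists_family_zmod46 {H : Type*} [AddCommGroup H] [Fintype H] [DecidableEq H] (hH : Fintype.card H = 46) {N : ℕ}
    (A B C : Fin N → Finset H) (hS : IsSTPP A B C) :
    ∃ A' B' C' : Fin N → Finset (ZMod 46), IsSTPP A' B' C' ∧ ∀ i, #(A' i) = #(A i) ∧ #(B' i) = #(B i) ∧ #(C' i) = #(C i) := by
  have hcard : Nat.card H = 46 := by rw [Nat.card_eq_fintype_card, hH]
  haveI : IsZGroup (Multiplicative H) := IsZGroup.of_squarefree (by rw [Nat.card_eq_fintype_card, Fintype.card_multiplicative, hH]; decide +kernel)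
  have hcyc : IsAddCyclic H := isCyclic_multiplicative_iff.1 inferInstance
  let e : H ≃+ ZMod 46 := ((zmodAddCyclicAddEquiv hcyc).symm).trans (ZMod.ringEquivCongr hcard).toAddEquiv
  refine ⟨fun i => (A i).image e, fun i => (B i).image e, fun i => (C i).image e, hS.map_addEquiv e, fun i => ⟨?_, ?_, ?_⟩⟩ <;>
    exact Finset.card_image_of_injective _ e.injective

/-! ## §2 Scaling by a unit and translations in `ℤ/46ℤ` -/

/-- Scaling every set of an STPP family by a unit of `ℤ/46ℤ` preserves the STPP. [cite: CohnKleinbergSzegedyUmans2005, Def. 5.1] -/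
theorem isSTPP_image_mul {N : ℕ} {A B C : Fin N → Finset (ZMod 46)} (hS : IsSTPP A B C) (u : (ZMod 46)ˣ) :
    IsSTPP (fun i => (A i).image (fun x => (u : ZMod 46) * x)) (fun i => (B i).image (fun x => (u : ZMod 46) * x))
      (fun i => (C i).image (fun x => (u : ZMod 46) * x)) := by
  have h := hS.map_of_injective (AddMonoidHom.mulLeft (u : ZMod 46)) (fun x y hxy => by
    simpa using congrArg (fun z => (↑u⁻¹ : ZMod 46) * z) hxy)
  simpa using h

/-- Scaling a progression scales first term and difference. [folklore] -/
theorem image_mul_apFinset (u a d : ZMod 46) (n : ℕ) : (apFinset a d n).image (fun x => u * x) = apFinset (u * a) (u * d) n := by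
  ext x
  simp only [Finset.mem_image, mem_apFinset]
  constructor
  · rintro ⟨y, ⟨i, hi, rfl⟩, rfl⟩
    exact ⟨i, hi, by simp only [nsmul_eq_mul]; ring⟩
  · rintro ⟨i, hi, rfl⟩
    exact ⟨a + i • d, ⟨i, hi, rfl⟩, by simp only [nsmul_eq_mul]; ring⟩

/-- Scaling by a unit preserves «is a progression», scaling the difference. [folklore] -/
theorem IsAP.image_mul {S : Finset (ZMod 46)} {d : ZMod 46} (h : IsAP S d) (u : (ZMod 46)ˣ) :
    IsAP (S.image (fun x => (u : ZMod 46) * x)) ((u : ZMod 46) * d) := by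
  obtain ⟨a, ha⟩ := h
  refine ⟨(u : ZMod 46) * a, ?_⟩
  have hinj : Function.Injective (fun x : ZMod 46 => (u : ZMod 46) * x) := fun x y hxy => by
    simpa using congrArg (fun z => (↑u⁻¹ : ZMod 46) * z) hxy
  rw [Finset.card_image_of_injective _ hinj]
  conv_lhs => rw [ha]
  rw [image_mul_apFinset]

/-- Translating a progression translates its first term. [folklore] -/
theorem image_add_apFinset (t a d : ZMod 46) (n : ℕ) : (apFinset a d n).image (· + t) = apFinset (a + t) d n := by
  ext x
  simp only [Finset.mem_image, mem_apFinset]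
  constructor
  · rintro ⟨y, ⟨i, hi, rfl⟩, rfl⟩; exact ⟨i, hi, by abel⟩
  · rintro ⟨i, hi, rfl⟩; exact ⟨a + i • d, ⟨i, hi, rfl⟩, by abel⟩

/-- A pair `{c, c + d}` under scaling by `u`. [folklore] -/
theorem image_mul_pair (u c d : ZMod 46) : ({c, c + d} : Finset (ZMod 46)).image (fun x => u * x) = {u * c, u * c + u * d} := by
  rw [Finset.image_insert, Finset.image_singleton, mul_add]

/-- A pair `{c, c + d}` under translation by `t`. [folklore] -/
theorem image_add_pair (t c d : ZMod 46) : ({c, c + d} : Finset (ZMod 46)).image (· + t) = {c + t, c + t + d} := by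
  rw [Finset.image_insert, Finset.image_singleton]
  congr 1
  rw [Finset.singleton_inj]; abel

/-! ## §3 Example normal form: `Cⱼ = {0, 1}` -/

/-- **Normal form for a unit step:** if `Cⱼ = {c, c + d}` with `d` a unit of `ℤ/46ℤ`, there is an STPP family with the same card vectors and `Cⱼ = {0, 1}`
(scale by `d⁻¹`, then translate block `j` by `−d⁻¹c`).  [cite: CohnKleinbergSzegedyUmans2005, Def. 5.1] -/
theorem normalize_C {N : ℕ} {A B C : Fin N → Finset (ZMod 46)} (hS : IsSTPP A B C) {j : Fin N} {c d : ZMod 46} (hd : IsUnit d)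
    (hCj : C j = {c, c + d}) :
    ∃ A' B' C' : Fin N → Finset (ZMod 46), IsSTPP A' B' C' ∧ (∀ i, #(A' i) = #(A i) ∧ #(B' i) = #(B i) ∧ #(C' i) = #(C i)) ∧
      C' j = {0, 1} := by
  obtain ⟨u, hu⟩ := hd
  -- scale by `u⁻¹`
  set v : (ZMod 46)ˣ := u⁻¹ with hv
  have hvd : (v : ZMod 46) * d = 1 := by rw [← hu, hv, Units.inv_mul]
  have hinj : Function.Injective (fun x : ZMod 46 => (v : ZMod 46) * x) := fun x y hxy => by
    simpa using congrArg (fun z => (↑v⁻¹ : ZMod 46) * z) hxy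
  have hS1 := isSTPP_image_mul hS v
  -- translate block `j` (all three sets) by `−v c`
  set t : Fin N → ZMod 46 := fun i => if i = j then -((v : ZMod 46) * c) else 0 with ht
  have hS2 := hS1.translate t
  refine ⟨_, _, _, hS2, fun i => ⟨?_, ?_, ?_⟩, ?_⟩
  · simp only [Finset.card_image_of_injective _ (add_left_injective (t i)), Finset.card_image_of_injective _ hinj]
  · simp only [Finset.card_image_of_injective _ (add_left_injective (t i)), Finset.card_image_of_injective _ hinj]
  · simp only [Finset.card_image_of_injective _ (add_left_injective (t i)), Finset.card_image_of_injective _ hinj]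
  · simp only [ht, if_pos rfl, hCj, image_mul_pair, hvd, image_add_pair]
    congr 1 <;> [skip; rw [Finset.singleton_inj]] <;> abel

end Summit.MatrixMultiplication.OmegaCensus.Z46
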